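import Literature.Topology.FourManifolds.CrossingFrame
import Literature.Topology.FourManifolds.RailNeck
import Literature.Topology.FourManifolds.BandSumModel
import HarnessLib

/-!
# The spike model at the crossing point

Topic `Literature/Topology/FourManifolds` (trunk T-4MAN). Fact seat
`provefact-Literature.Topology.FourManifolds.Knot.IsConnectedSum.isIsotopic` (Schubert's theorem),
stage S1 of the proof of the geometric heart for rail knots. At the scale `κ` of the neck
(`RailNeck.lean`) the two rails pass the crossing point `band (1/2, 1/2)` at the heights `1/2 ∓ κ`;
read in the chart `ψ` from the north pole and in the blow-up coordinates of the crossing frame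
(`CrossingFrame.lean`: `Y = κ⁻¹ frame⁻¹ (y - pZero)`) they are, up to an error `ε (|α| + 1)`
controlled by the flatness of the band, the two lines `α ↦ (α, ∓1, 0)`. This file replaces a
portion of each rail by a **spike**: a straight segment of `ψ`-space pointing at the common centre
`oS = pZero + κ frame (1, 0, σ)` (radial for the cut-off homothety of `CutoffHomothety.lean`),
followed by a return to the rail, through a smooth one-parameter family starting at the rail.

* `spikeBump` — smooth, `1` on `[1/4, 3]`, `0` off `(1/8, 4)`; `modelLo σ`, `modelHi σ` — the model
  paths in blow-up coordinates: graphs over the first coordinate, straight from the base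
  `(1/4, ∓1, 0)` towards `(1, 0, σ)` for `α ∈ [1/4, 3/4]`, back on the model rail for `α ≥ 7/8`
  (`modelLo_apply_zero`, `modelLo_of_le`/`_of_ge`, `modelLo_one_le`: second coordinate `≤ -1/6`).
* `b.railLoPsi κ α = Fband (κ α, -κ)`, `b.railHiPsi κ α = Fband (κ α, κ)` — the necked rails at
  scale `κ` in the blown-up parameter; `b.pieceLo hcross κ σ u α`, `b.pieceHi …` — the **spiked
  pieces**: `(1 - u β α) • rail + (u β α) • blowDown κ (model α)`, equal to the rail off `(1/8, 4)`
  and for `u = 0`, exactly straight and radial from `b.oS hcross κ σ` on `[1/4, 3/4]` at `u = 1`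
  (`pieceLo_one_eq_lineLo`, `lineLo_mem_segment`).
* Estimates in the flat regime (`b.IsFlat hcross ε r`: the conclusions of
  `CrossingFrame.exists_flat(_fderiv)`; `exists_isFlat`), at a scale `κ > 0` with `κ (|α| + 1) < r`:
  the rails are `ε (|α| + 1)`-close to the model rails in blow-up coordinates with derivative
  `ε`-close to `(1, 0, 0)` (`norm_blowUp_railLoPsi_sub_le`, `hasDerivAt_blowUp_railLoPsi`); the
  first blow-up coordinate of the pieces has derivative `≥ 1 - ε - B ε (|α| + 1)`
  (`hasDerivAt_blowUp_pieceLo_zero`, `B = bumpBound` a bound for `|spikeBump'|`), hence is strictly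
  increasing on `[-A, A]` when `ε (1 + B (A + 1)) ≤ 1/2` (`strictMonoOn_blowUp_pieceLo_zero`), so the
  pieces are injective there (`injOn_pieceLo`) and regular (`ne_zero_of_hasDerivAt_pieceLo`); the
  second blow-up coordinate is `≤ -1/6` on the lower and `≥ 1/6` on the upper piece
  (`blowUp_pieceLo_one_le`, `le_blowUp_pieceHi_one`), so the two pieces are disjoint
  (`pieceLo_ne_pieceHi`); the pieces stay within blow-up norm `|α| + 2 + |σ|`
  (`norm_blowUp_pieceLo_le`, and `norm_sub_pZero_le` converts to distance `O(κ)` from `pZero`);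
  all of this for every family parameter `u ∈ [0, 1]`. The pieces are jointly `C^∞` in `(u, α)`
  (`contDiffAt_pieceLo`).

Everything is proved; no named facts are introduced.

## References

Standard; all statements `[folklore]`.
-/

open scoped Manifold ContDiff Topology Real
open Function Set Metric Filter

noncomputable section

namespace Literature.Topology.FourManifolds

/-- Local notation: `𝔼 n` is the model Euclidean space `EuclideanSpace ℝ (Fin n)`. -/
local notation "𝔼 " n:arg => EuclideanSpace ℝ (Fin n)

/-- Local notation: `𝕊 n` is the unit sphere in `EuclideanSpace ℝ (Fin (n + 1))`. -/
local notation "𝕊 " n:arg => (Metric.sphere (0 : EuclideanSpace ℝ (Fin (n + 1))) 1)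

attribute [local instance] fact_finrank_euclideanSpace_succ

/-! ### The bump and the model paths in blow-up coordinates -/

/-- A point of `ℝ³` from its three coordinates. [folklore] -/
abbrev pt3 (x y z : ℝ) : 𝔼 3 := WithLp.toLp 2 ![x, y, z]

/-- Coordinates of `pt3`. [folklore] -/
@[simp] theorem pt3_apply_zero (x y z : ℝ) : pt3 x y z 0 = x := rfl

/-- Coordinates of `pt3`. [folklore] -/
@[simp] theorem pt3_apply_one (x y z : ℝ) : pt3 x y z 1 = y := rfl

/-- Coordinates of `pt3`. [folklore] -/
@[simp] theorem pt3_apply_two (x y z : ℝ) : pt3 x y z 2 = z := rfl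

/-- Every point of `ℝ³` is `pt3` of its coordinates. [folklore] -/
theorem pt3_eta (Y : 𝔼 3) : pt3 (Y 0) (Y 1) (Y 2) = Y := by
  ext i; fin_cases i <;> rfl

/-- **The spike bump**: `1` on `[1/4, 3]`, `0` off `(1/8, 4)`. [folklore] -/
def spikeBump (α : ℝ) : ℝ := smoothStep (1 / 8) (1 / 4) α * (1 - smoothStep 3 4 α)

/-- The spike bump is `C^∞`. [folklore] -/
theorem contDiff_spikeBump : ContDiff ℝ ∞ spikeBump :=
  (contDiff_smoothStep _ _).mul (contDiff_const.sub (contDiff_smoothStep _ _))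

/-- The spike bump takes values in `[0, 1]`. [folklore] -/
theorem spikeBump_mem_Icc (α : ℝ) : spikeBump α ∈ Icc (0 : ℝ) 1 := by
  have h1 := smoothStep_mem_Icc (1 / 8) (1 / 4) α
  have h2 := smoothStep_mem_Icc 3 4 α
  refine ⟨mul_nonneg h1.1 (by linarith [h2.2]), ?_⟩
  calc spikeBump α ≤ 1 * 1 := mul_le_mul h1.2 (by linarith [h2.1]) (by linarith [h2.2]) zero_le_one
    _ = 1 := one_mul 1

/-- The spike bump is `1` on `[1/4, 3]`. [folklore] -/
theorem spikeBump_eq_one {α : ℝ} (h : α ∈ Icc (1 / 4 : ℝ) 3) : spikeBump α = 1 := by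
  rw [spikeBump, smoothStep_of_ge (by norm_num) h.1, smoothStep_of_le (by norm_num) h.2]; ring

/-- The spike bump vanishes left of `1/8`. [folklore] -/
theorem spikeBump_eq_zero_of_le {α : ℝ} (h : α ≤ 1 / 8) : spikeBump α = 0 := by
  rw [spikeBump, smoothStep_of_le (by norm_num) h]; ring

/-- The spike bump vanishes right of `4`. [folklore] -/
theorem spikeBump_eq_zero_of_ge {α : ℝ} (h : 4 ≤ α) : spikeBump α = 0 := by
  rw [spikeBump, smoothStep_of_ge (by norm_num) h]; ring

/-- The spike bump vanishes off `(1/8, 4)`. [folklore] -/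
theorem spikeBump_eq_zero_of_not_mem {α : ℝ} (h : α ∉ Ioo (1 / 8 : ℝ) 4) : spikeBump α = 0 := by
  rcases le_or_gt α (1 / 8) with h1 | h1
  · exact spikeBump_eq_zero_of_le h1
  · exact spikeBump_eq_zero_of_ge (not_lt.1 fun h2 ↦ h ⟨h1, h2⟩)

/-- The return step `γ = smoothStep (3/4) (7/8)`. [folklore] -/
def returnStep (α : ℝ) : ℝ := smoothStep (3 / 4) (7 / 8) α

/-- The return step is `C^∞`. [folklore] -/
theorem contDiff_returnStep : ContDiff ℝ ∞ returnStep := contDiff_smoothStep _ _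

/-- The return step takes values in `[0, 1]`. [folklore] -/
theorem returnStep_mem_Icc (α : ℝ) : returnStep α ∈ Icc (0 : ℝ) 1 := smoothStep_mem_Icc _ _ _

/-- The return step vanishes left of `3/4`. [folklore] -/
theorem returnStep_eq_zero {α : ℝ} (h : α ≤ 3 / 4) : returnStep α = 0 := smoothStep_of_le (by norm_num) h

/-- The return step is `1` right of `7/8`. [folklore] -/
theorem returnStep_eq_one {α : ℝ} (h : 7 / 8 ≤ α) : returnStep α = 1 := smoothStep_of_ge (by norm_num) h

/-- The spike profile `s α = (1 - γ α) (α - 1/4) / (3/4)`: the fraction of the way from the base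
towards the centre. [folklore] -/
def spikeProfile (α : ℝ) : ℝ := (1 - returnStep α) * ((α - 1 / 4) / (3 / 4))

/-- The spike profile is `C^∞`. [folklore] -/
theorem contDiff_spikeProfile : ContDiff ℝ ∞ spikeProfile :=
  (contDiff_const.sub contDiff_returnStep).mul ((contDiff_id.sub contDiff_const).div_const _)

/-- Left of `3/4` the spike profile is affine: `(α - 1/4)/(3/4)`. [folklore] -/
theorem spikeProfile_of_le {α : ℝ} (h : α ≤ 3 / 4) : spikeProfile α = (α - 1 / 4) / (3 / 4) := by
  rw [spikeProfile, returnStep_eq_zero h]; ring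

/-- Right of `7/8` the spike profile vanishes. [folklore] -/
theorem spikeProfile_of_ge {α : ℝ} (h : 7 / 8 ≤ α) : spikeProfile α = 0 := by
  rw [spikeProfile, returnStep_eq_one h]; ring

/-- **The spike profile stays below `5/6`** (the straight part stops at the fraction `2/3`, the
return happens before the fraction `5/6`). [folklore] -/
theorem spikeProfile_le (α : ℝ) : spikeProfile α ≤ 5 / 6 := by
  rcases le_or_gt α (7 / 8) with h | h
  · have hγ := returnStep_mem_Icc α
    rw [spikeProfile]
    have h1 : (α - 1 / 4) / (3 / 4) ≤ 5 / 6 := by rw [div_le_iff₀ (by norm_num)]; linarith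
    rcases le_or_gt (1 / 4) α with h2 | h2
    · have h3 : 0 ≤ (α - 1 / 4) / (3 / 4) := by positivity
      nlinarith [hγ.1, hγ.2]
    · have h3 : (α - 1 / 4) / (3 / 4) ≤ 0 := by rw [div_le_iff₀ (by norm_num)]; linarith
      nlinarith [hγ.1, hγ.2]
  · rw [spikeProfile_of_ge h.le]; norm_num

/-- The spike profile is at most the affine fraction when the latter is nonnegative. [folklore] -/
theorem spikeProfile_le_frac {α : ℝ} (h : 1 / 4 ≤ α) : spikeProfile α ≤ (α - 1 / 4) / (3 / 4) := by
  have hγ := returnStep_mem_Icc α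
  have h3 : 0 ≤ (α - 1 / 4) / (3 / 4) := by positivity
  rw [spikeProfile]; nlinarith [hγ.1]

/-- The spike profile is nonnegative right of the base. [folklore] -/
theorem spikeProfile_nonneg {α : ℝ} (h : 1 / 4 ≤ α) : 0 ≤ spikeProfile α := by
  have hγ := returnStep_mem_Icc α
  rw [spikeProfile]
  exact mul_nonneg (by linarith [hγ.2]) (by positivity)

/-- **The lower model path** in blow-up coordinates: `(α, -1 + s α, σ s α)`. [folklore] -/
def modelLo (σ α : ℝ) : 𝔼 3 := pt3 α (-1 + spikeProfile α) (σ * spikeProfile α)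

/-- **The upper model path** in blow-up coordinates: `(α, 1 - s α, σ s α)`. [folklore] -/
def modelHi (σ α : ℝ) : 𝔼 3 := pt3 α (1 - spikeProfile α) (σ * spikeProfile α)

/-- First coordinate of the lower model path: the path is a graph over it. [folklore] -/
@[simp] theorem modelLo_apply_zero (σ α : ℝ) : modelLo σ α 0 = α := rfl

/-- Second coordinate of the lower model path. [folklore] -/
@[simp] theorem modelLo_apply_one (σ α : ℝ) : modelLo σ α 1 = -1 + spikeProfile α := rfl

/-- Third coordinate of the lower model path. [folklore] -/
@[simp] theorem modelLo_apply_two (σ α : ℝ) : modelLo σ α 2 = σ * spikeProfile α := rfl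

/-- First coordinate of the upper model path. [folklore] -/
@[simp] theorem modelHi_apply_zero (σ α : ℝ) : modelHi σ α 0 = α := rfl

/-- Second coordinate of the upper model path. [folklore] -/
@[simp] theorem modelHi_apply_one (σ α : ℝ) : modelHi σ α 1 = 1 - spikeProfile α := rfl

/-- Third coordinate of the upper model path. [folklore] -/
@[simp] theorem modelHi_apply_two (σ α : ℝ) : modelHi σ α 2 = σ * spikeProfile α := rfl

/-- The lower model path is `C^∞`. [folklore] -/
theorem contDiff_modelLo (σ : ℝ) : ContDiff ℝ ∞ (modelLo σ) := by
  rw [contDiff_euclidean]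
  intro i
  fin_cases i
  · exact contDiff_id
  · exact contDiff_const.add contDiff_spikeProfile
  · exact contDiff_const.mul contDiff_spikeProfile

/-- The upper model path is `C^∞`. [folklore] -/
theorem contDiff_modelHi (σ : ℝ) : ContDiff ℝ ∞ (modelHi σ) := by
  rw [contDiff_euclidean]
  intro i
  fin_cases i
  · exact contDiff_id
  · exact contDiff_const.sub contDiff_spikeProfile
  · exact contDiff_const.mul contDiff_spikeProfile

/-- **Right of `7/8` the lower model path is the model rail** `(α, -1, 0)`. [folklore] -/
theorem modelLo_of_ge {σ α : ℝ} (h : 7 / 8 ≤ α) : modelLo σ α = pt3 α (-1) 0 := by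
  simp [modelLo, spikeProfile_of_ge h]

/-- Right of `7/8` the upper model path is the model rail `(α, 1, 0)`. [folklore] -/
theorem modelHi_of_ge {σ α : ℝ} (h : 7 / 8 ≤ α) : modelHi σ α = pt3 α 1 0 := by
  simp [modelHi, spikeProfile_of_ge h]

/-- **The second coordinate of the lower model path stays `≤ -1/6`.** [folklore] -/
theorem modelLo_one_le (σ α : ℝ) : modelLo σ α 1 ≤ -(1 / 6) := by
  rw [modelLo_apply_one]; linarith [spikeProfile_le α]

/-- **The second coordinate of the upper model path stays `≥ 1/6`.** [folklore] -/
theorem modelHi_one_ge (σ α : ℝ) : 1 / 6 ≤ modelHi σ α 1 := by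
  rw [modelHi_apply_one]; linarith [spikeProfile_le α]

/-- The lower line through the base `(1/4, -1, 0)` towards the centre `(1, 0, σ)`, parametrised by
its first coordinate. [folklore] -/
def lineLo (σ α : ℝ) : 𝔼 3 := pt3 α (-1 + (α - 1 / 4) / (3 / 4)) (σ * ((α - 1 / 4) / (3 / 4)))

/-- The upper line through the base `(1/4, 1, 0)` towards the centre `(1, 0, σ)`. [folklore] -/
def lineHi (σ α : ℝ) : 𝔼 3 := pt3 α (1 - (α - 1 / 4) / (3 / 4)) (σ * ((α - 1 / 4) / (3 / 4)))

/-- **Left of `3/4` the lower model path is the lower line.** [folklore] -/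
theorem modelLo_of_le {σ α : ℝ} (h : α ≤ 3 / 4) : modelLo σ α = lineLo σ α := by
  simp [modelLo, lineLo, spikeProfile_of_le h]

/-- Left of `3/4` the upper model path is the upper line. [folklore] -/
theorem modelHi_of_le {σ α : ℝ} (h : α ≤ 3 / 4) : modelHi σ α = lineHi σ α := by
  simp [modelHi, lineHi, spikeProfile_of_le h]

/-- **The lower line is radial from the centre**: `lineLo α = d₀ + (1 - s) (B₀ - d₀)` with
`s = (α - 1/4)/(3/4)`, `B₀ = (1/4, -1, 0)`, `d₀ = (1, 0, σ)`. [folklore] -/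
theorem lineLo_eq (σ α : ℝ) :
    lineLo σ α = pt3 1 0 σ + (1 - (α - 1 / 4) / (3 / 4)) • (pt3 (1 / 4) (-1) 0 - pt3 1 0 σ) := by
  ext i; fin_cases i <;> simp [lineLo] <;> ring

/-- The upper line is radial from the centre. [folklore] -/
theorem lineHi_eq (σ α : ℝ) :
    lineHi σ α = pt3 1 0 σ + (1 - (α - 1 / 4) / (3 / 4)) • (pt3 (1 / 4) 1 0 - pt3 1 0 σ) := by
  ext i; fin_cases i <;> simp [lineHi] <;> ring

namespace BandData

variable {A B K : Knot} {avoid : Set (𝕊 3)} (b : BandData A B K avoid)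
  (hcross : b.band ⁻¹' sphereEquator 2 ∩ squareNhd b.δ = {x ∈ squareNhd b.δ | x 0 = 2⁻¹})

/-! ### The rails at scale `κ` and the spiked pieces -/

/-- **The lower necked rail at scale `κ`, read in the chart**, in the blown-up parameter:
`Fband (κ α, -κ)` (the band point `(1/2 + κ α, 1/2 - κ)`). [folklore] -/
def railLoPsi (κ α : ℝ) : 𝔼 3 := b.Fband (pt2 (κ * α) (-κ))

/-- **The upper necked rail at scale `κ`, read in the chart**: `Fband (κ α, κ)`. [folklore] -/
def railHiPsi (κ α : ℝ) : 𝔼 3 := b.Fband (pt2 (κ * α) κ)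

/-- **The centre** of the spikes and of the contraction: `pZero + κ frame (1, 0, σ)`. [folklore] -/
def oS (κ σ : ℝ) : 𝔼 3 := b.blowDown hcross κ (pt3 1 0 σ)

/-- **The spiked lower piece** (family parameter `u`, blown-up parameter `α`): the convex
combination with weight `u β α` of the rail and the blown-down lower model path. [folklore] -/
def pieceLo (κ σ u α : ℝ) : 𝔼 3 :=
  (1 - u * spikeBump α) • b.railLoPsi κ α + (u * spikeBump α) • b.blowDown hcross κ (modelLo σ α)

/-- **The spiked upper piece.** [folklore] -/
def pieceHi (κ σ u α : ℝ) : 𝔼 3 :=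
  (1 - u * spikeBump α) • b.railHiPsi κ α + (u * spikeBump α) • b.blowDown hcross κ (modelHi σ α)

/-- Off `(1/8, 4)` the spiked lower piece is the rail. [folklore] -/
theorem pieceLo_eq_rail {κ σ u α : ℝ} (h : α ∉ Ioo (1 / 8 : ℝ) 4) : b.pieceLo hcross κ σ u α = b.railLoPsi κ α := by
  simp [pieceLo, spikeBump_eq_zero_of_not_mem h]

/-- Off `(1/8, 4)` the spiked upper piece is the rail. [folklore] -/
theorem pieceHi_eq_rail {κ σ u α : ℝ} (h : α ∉ Ioo (1 / 8 : ℝ) 4) : b.pieceHi hcross κ σ u α = b.railHiPsi κ α := by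
  simp [pieceHi, spikeBump_eq_zero_of_not_mem h]

/-- At `u = 0` the spiked lower piece is the rail. [folklore] -/
@[simp] theorem pieceLo_zero (κ σ α : ℝ) : b.pieceLo hcross κ σ 0 α = b.railLoPsi κ α := by
  simp [pieceLo]

/-- At `u = 0` the spiked upper piece is the rail. [folklore] -/
@[simp] theorem pieceHi_zero (κ σ α : ℝ) : b.pieceHi hcross κ σ 0 α = b.railHiPsi κ α := by
  simp [pieceHi]

/-- **At `u = 1`, on `[1/4, 3/4]`, the spiked lower piece is the blown-down lower line**: a
straight segment of the chart. [folklore] -/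
theorem pieceLo_one_eq_lineLo {κ σ α : ℝ} (h : α ∈ Icc (1 / 4 : ℝ) (3 / 4)) :
    b.pieceLo hcross κ σ 1 α = b.blowDown hcross κ (lineLo σ α) := by
  have hβ : spikeBump α = 1 := spikeBump_eq_one ⟨h.1, by linarith [h.2]⟩
  simp [pieceLo, hβ, modelLo_of_le h.2]

/-- At `u = 1`, on `[1/4, 3/4]`, the spiked upper piece is the blown-down upper line. [folklore] -/
theorem pieceHi_one_eq_lineHi {κ σ α : ℝ} (h : α ∈ Icc (1 / 4 : ℝ) (3 / 4)) :
    b.pieceHi hcross κ σ 1 α = b.blowDown hcross κ (lineHi σ α) := by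
  have hβ : spikeBump α = 1 := spikeBump_eq_one ⟨h.1, by linarith [h.2]⟩
  simp [pieceHi, hβ, modelHi_of_le h.2]

/-- **The straight part of the lower spike is radial from the centre**: `blowDown κ (lineLo α)` lies
on the segment from the centre `oS` to the blown-down base, at the fraction `1 - s`,
`s = (α - 1/4)/(3/4) ∈ [0, 2/3]`. [folklore] -/
theorem blowDown_lineLo_eq (κ σ α : ℝ) :
    b.blowDown hcross κ (lineLo σ α) =
      b.oS hcross κ σ + (1 - (α - 1 / 4) / (3 / 4)) • (b.blowDown hcross κ (pt3 (1 / 4) (-1) 0) - b.oS hcross κ σ) := by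
  rw [lineLo_eq, oS, blowDown_sub]
  simp only [blowDown, map_add, map_smul, smul_add, smul_smul]
  rw [mul_comm]
  abel

/-- The straight part of the upper spike is radial from the centre. [folklore] -/
theorem blowDown_lineHi_eq (κ σ α : ℝ) :
    b.blowDown hcross κ (lineHi σ α) =
      b.oS hcross κ σ + (1 - (α - 1 / 4) / (3 / 4)) • (b.blowDown hcross κ (pt3 (1 / 4) 1 0) - b.oS hcross κ σ) := by
  rw [lineHi_eq, oS, blowDown_sub]
  simp only [blowDown, map_add, map_smul, smul_add, smul_smul]
  rw [mul_comm]
  abel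

/-! ### The blow-up coordinates of the pieces -/

/-- **The blow-up coordinates of the spiked lower piece**: the same convex combination of those of
the rail and of the model path (the blow-up map is affine). [folklore] -/
theorem blowUp_pieceLo {κ : ℝ} (hκ : κ ≠ 0) (σ u α : ℝ) :
    b.blowUp hcross κ (b.pieceLo hcross κ σ u α) =
      (1 - u * spikeBump α) • b.blowUp hcross κ (b.railLoPsi κ α) + (u * spikeBump α) • modelLo σ α := by
  simp only [blowUp, pieceLo, blowDown]
  set w := u * spikeBump α
  set R := b.railLoPsi κ α
  set M := modelLo σ α
  have e : (1 - w) • R + w • (b.pZero + κ • b.frame hcross M) - b.pZero =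
      (1 - w) • (R - b.pZero) + (w * κ) • b.frame hcross M := by
    rw [mul_smul]; module
  rw [e, map_add, map_smul, map_smul, ContinuousLinearEquiv.symm_apply_apply, smul_add, smul_smul,
    smul_smul, show κ⁻¹ * (w * κ) = w by field_simp, mul_comm κ⁻¹ (1 - w), ← smul_smul]

/-- The blow-up coordinates of the spiked upper piece. [folklore] -/
theorem blowUp_pieceHi {κ : ℝ} (hκ : κ ≠ 0) (σ u α : ℝ) :
    b.blowUp hcross κ (b.pieceHi hcross κ σ u α) =
      (1 - u * spikeBump α) • b.blowUp hcross κ (b.railHiPsi κ α) + (u * spikeBump α) • modelHi σ α := by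
  simp only [blowUp, pieceHi, blowDown]
  set w := u * spikeBump α
  set R := b.railHiPsi κ α
  set M := modelHi σ α
  have e : (1 - w) • R + w • (b.pZero + κ • b.frame hcross M) - b.pZero =
      (1 - w) • (R - b.pZero) + (w * κ) • b.frame hcross M := by
    rw [mul_smul]; module
  rw [e, map_add, map_smul, map_smul, ContinuousLinearEquiv.symm_apply_apply, smul_add, smul_smul,
    smul_smul, show κ⁻¹ * (w * κ) = w by field_simp, mul_comm κ⁻¹ (1 - w), ← smul_smul]

/-- First blow-up coordinate of the spiked lower piece: `(1 - uβ) φ(rail) + uβ α`. [folklore] -/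
theorem blowUp_pieceLo_zero {κ : ℝ} (hκ : κ ≠ 0) (σ u α : ℝ) :
    b.blowUp hcross κ (b.pieceLo hcross κ σ u α) 0 =
      (1 - u * spikeBump α) * b.blowUp hcross κ (b.railLoPsi κ α) 0 + u * spikeBump α * α := by
  rw [b.blowUp_pieceLo hcross hκ]; simp

/-- Second blow-up coordinate of the spiked lower piece. [folklore] -/
theorem blowUp_pieceLo_one {κ : ℝ} (hκ : κ ≠ 0) (σ u α : ℝ) :
    b.blowUp hcross κ (b.pieceLo hcross κ σ u α) 1 =
      (1 - u * spikeBump α) * b.blowUp hcross κ (b.railLoPsi κ α) 1 + u * spikeBump α * (-1 + spikeProfile α) := by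
  rw [b.blowUp_pieceLo hcross hκ]; simp

/-- First blow-up coordinate of the spiked upper piece. [folklore] -/
theorem blowUp_pieceHi_zero {κ : ℝ} (hκ : κ ≠ 0) (σ u α : ℝ) :
    b.blowUp hcross κ (b.pieceHi hcross κ σ u α) 0 =
      (1 - u * spikeBump α) * b.blowUp hcross κ (b.railHiPsi κ α) 0 + u * spikeBump α * α := by
  rw [b.blowUp_pieceHi hcross hκ]; simp

/-- Second blow-up coordinate of the spiked upper piece. [folklore] -/
theorem blowUp_pieceHi_one {κ : ℝ} (hκ : κ ≠ 0) (σ u α : ℝ) :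
    b.blowUp hcross κ (b.pieceHi hcross κ σ u α) 1 =
      (1 - u * spikeBump α) * b.blowUp hcross κ (b.railHiPsi κ α) 1 + u * spikeBump α * (1 - spikeProfile α) := by
  rw [b.blowUp_pieceHi hcross hκ]; simp

/-! ### A bound for the derivative of the bump -/

omit b hcross in
/-- The derivative of the spike bump vanishes left of `1/8`. [folklore] -/
theorem deriv_spikeBump_of_lt {α : ℝ} (h : α < 1 / 8) : deriv spikeBump α = 0 := by
  have hev : spikeBump =ᶠ[𝓝 α] fun _ ↦ (0 : ℝ) := by
    filter_upwards [Iio_mem_nhds h] with x hx using spikeBump_eq_zero_of_le hx.le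
  rw [hev.deriv_eq]; simp

omit b hcross in
/-- The derivative of the spike bump vanishes right of `4`. [folklore] -/
theorem deriv_spikeBump_of_gt {α : ℝ} (h : 4 < α) : deriv spikeBump α = 0 := by
  have hev : spikeBump =ᶠ[𝓝 α] fun _ ↦ (0 : ℝ) := by
    filter_upwards [Ioi_mem_nhds h] with x hx using spikeBump_eq_zero_of_ge hx.le
  rw [hev.deriv_eq]; simp

omit b hcross in
/-- **The derivative of the spike bump is bounded.** [folklore] -/
theorem exists_deriv_spikeBump_le : ∃ B' : ℝ, 0 ≤ B' ∧ ∀ α, |deriv spikeBump α| ≤ B' := by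
  have hc : Continuous (deriv spikeBump) := contDiff_spikeBump.continuous_deriv (by simp)
  obtain ⟨C, hC⟩ := (isCompact_Icc (a := (0 : ℝ)) (b := 5)).exists_bound_of_continuousOn hc.continuousOn
  refine ⟨max C 0, le_max_right _ _, fun α ↦ ?_⟩
  by_cases hα : α ∈ Icc (0 : ℝ) 5
  · exact (Real.norm_eq_abs _ ▸ hC α hα).trans (le_max_left _ _)
  · rw [mem_Icc, not_and_or, not_le, not_le] at hα
    rcases hα with h | h
    · rw [deriv_spikeBump_of_lt (by linarith), abs_zero]; exact le_max_right _ _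
    · rw [deriv_spikeBump_of_gt (by linarith), abs_zero]; exact le_max_right _ _

omit b hcross in
/-- **The bump derivative bound** (chosen). [folklore] -/
def bumpBound : ℝ := exists_deriv_spikeBump_le.choose

omit b hcross in
/-- The bump derivative bound is nonnegative and bounds the derivative. [folklore] -/
theorem bumpBound_spec : 0 ≤ bumpBound ∧ ∀ α, |deriv spikeBump α| ≤ bumpBound :=
  exists_deriv_spikeBump_le.choose_spec

omit b hcross in
/-- The spike bump has derivative `deriv spikeBump α` at `α`. [folklore] -/
theorem hasDerivAt_spikeBump (α : ℝ) : HasDerivAt spikeBump (deriv spikeBump α) α :=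
  ((contDiff_spikeBump.differentiable (by simp)) α).hasDerivAt

/-! ### Flatness packages and the scale condition -/

/-- **Flatness package** at tolerance `ε` and radius `r`: the conclusions of
`CrossingFrame.exists_flat` and `exists_flat_fderiv`. [folklore] -/
structure IsFlat (ε r : ℝ) : Prop where
  r_pos : 0 < r
  r_le : r ≤ b.poleRad hcross
  flat : ∀ q q' : 𝔼 2, ‖q‖ < r → ‖q'‖ < r →
    ‖(b.frame hcross).symm (b.Fband q - b.Fband q') - WithLp.toLp 2 ![q 0 - q' 0, q 1 - q' 1, 0]‖ ≤ ε * ‖q - q'‖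
  flat_fderiv : ∀ q : 𝔼 2, ‖q‖ < r → ∀ w : 𝔼 2,
    ‖(b.frame hcross).symm (fderiv ℝ b.Fband q w) - WithLp.toLp 2 ![w 0, w 1, 0]‖ ≤ ε * ‖w‖

/-- **Flatness packages exist for every tolerance.** [folklore] -/
theorem exists_isFlat {ε : ℝ} (hε : 0 < ε) : ∃ r, b.IsFlat hcross ε r := by
  obtain ⟨r₁, hr₁, hr₁le, h₁⟩ := b.exists_flat hcross hε
  obtain ⟨r₂, hr₂, -, h₂⟩ := b.exists_flat_fderiv hcross hε
  refine ⟨min r₁ r₂, ⟨lt_min hr₁ hr₂, (min_le_left _ _).trans hr₁le, fun q q' hq hq' ↦ ?_, fun q hq w ↦ ?_⟩⟩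
  · exact h₁ q q' (lt_of_lt_of_le hq (min_le_left _ _)) (lt_of_lt_of_le hq' (min_le_left _ _))
  · exact h₂ q (lt_of_lt_of_le hq (min_le_right _ _)) w

omit b hcross in
/-- The norm of `(x, y)` is at most `|x| + |y|`. [folklore] -/
theorem norm_pt2_le (x y : ℝ) : ‖(pt2 x y : 𝔼 2)‖ ≤ |x| + |y| := by
  have e : (pt2 x y : 𝔼 2) = x • pt2 1 0 + y • pt2 0 1 := by
    ext i; fin_cases i <;> simp
  rw [e]
  refine (norm_add_le _ _).trans ?_
  rw [norm_smul, norm_smul, Real.norm_eq_abs, Real.norm_eq_abs]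
  have h1 : ‖(pt2 1 0 : 𝔼 2)‖ = 1 := by
    rw [EuclideanSpace.norm_eq]; simp [Fin.sum_univ_two]
  have h2 : ‖(pt2 0 1 : 𝔼 2)‖ = 1 := by
    rw [EuclideanSpace.norm_eq]; simp [Fin.sum_univ_two]
  rw [h1, h2]; linarith

omit b hcross in
/-- The norm of the rail parameter point `(κ α, ∓κ)` is at most `κ (|α| + 1)`. [folklore] -/
theorem norm_railParam_le {κ : ℝ} (hκ : 0 < κ) (α s : ℝ) (hs : |s| = 1) :
    ‖(pt2 (κ * α) (s * κ) : 𝔼 2)‖ ≤ κ * (|α| + 1) := by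
  refine (norm_pt2_le _ _).trans ?_
  rw [abs_mul, abs_mul, hs, abs_of_pos hκ]; linarith

/-- The tolerance of a flatness package is nonnegative. [folklore] -/
theorem IsFlat.eps_nonneg {ε r : ℝ} (hf : b.IsFlat hcross ε r) : 0 ≤ ε := by
  by_contra hneg
  push Not at hneg
  have h1 := hf.flat_fderiv 0 (by simpa using hf.r_pos) (pt2 1 0)
  have hn : ‖(pt2 1 0 : 𝔼 2)‖ = 1 := by rw [EuclideanSpace.norm_eq]; simp [Fin.sum_univ_two]
  rw [hn, mul_one] at h1
  linarith [norm_nonneg ((b.frame hcross).symm (fderiv ℝ b.Fband 0 (pt2 1 0)) - WithLp.toLp 2 ![(pt2 1 0 : 𝔼 2) 0, (pt2 1 0 : 𝔼 2) 1, 0])]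

/-! ### Flatness of the rails in blow-up coordinates -/

section Estimates

variable {hcross} {ε r κ : ℝ} (hf : b.IsFlat hcross ε r) (hκ : 0 < κ)
include hf hκ

omit b hf in
/-- The lower rail parameter point lies within the flatness radius when `κ (|α| + 1) < r`.
[folklore] -/
theorem norm_railLoParam_lt {α : ℝ} (hα : κ * (|α| + 1) < r) : ‖(pt2 (κ * α) (-κ) : 𝔼 2)‖ < r := by
  have := norm_railParam_le hκ α (-1) (by simp)
  rw [neg_one_mul] at this
  exact this.trans_lt hα

omit b hf in
/-- The upper rail parameter point lies within the flatness radius when `κ (|α| + 1) < r`.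
[folklore] -/
theorem norm_railHiParam_lt {α : ℝ} (hα : κ * (|α| + 1) < r) : ‖(pt2 (κ * α) κ : 𝔼 2)‖ < r := by
  have := norm_railParam_le hκ α 1 (by simp)
  rw [one_mul] at this
  exact this.trans_lt hα

/-- **Flatness of the lower rail in blow-up coordinates**: `‖blowUp κ (railLoPsi κ α) - (α, -1, 0)‖ ≤ ε (|α| + 1)`.
[folklore] -/
theorem norm_blowUp_railLoPsi_sub_le {α : ℝ} (hα : κ * (|α| + 1) < r) :
    ‖b.blowUp hcross κ (b.railLoPsi κ α) - pt3 α (-1) 0‖ ≤ ε * (|α| + 1) := by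
  have hq := norm_railLoParam_lt hκ hα
  have key := hf.flat (pt2 (κ * α) (-κ)) 0 hq (by simpa using hf.r_pos)
  have hF0 : b.Fband 0 = b.pZero := rfl
  rw [hF0, sub_zero] at key
  have e : b.blowUp hcross κ (b.railLoPsi κ α) - pt3 α (-1) 0 =
      κ⁻¹ • ((b.frame hcross).symm (b.Fband (pt2 (κ * α) (-κ)) - b.pZero) -
        WithLp.toLp 2 ![(pt2 (κ * α) (-κ) : 𝔼 2) 0 - (0 : 𝔼 2) 0, (pt2 (κ * α) (-κ) : 𝔼 2) 1 - (0 : 𝔼 2) 1, 0]) := by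
    rw [smul_sub, blowUp, railLoPsi]
    congr 1
    ext i; fin_cases i <;> simp [hκ.ne']
  rw [e, norm_smul, Real.norm_eq_abs, abs_inv, abs_of_pos hκ]
  have hε : 0 ≤ ε := hf.eps_nonneg
  calc κ⁻¹ * _ ≤ κ⁻¹ * (ε * ‖(pt2 (κ * α) (-κ) : 𝔼 2)‖) := by gcongr
    _ ≤ κ⁻¹ * (ε * (κ * (|α| + 1))) := by
        have := norm_railParam_le hκ α (-1) (by simp)
        rw [neg_one_mul] at this
        gcongr
    _ = ε * (|α| + 1) := by field_simp

/-- **Flatness of the upper rail in blow-up coordinates.** [folklore] -/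
theorem norm_blowUp_railHiPsi_sub_le {α : ℝ} (hα : κ * (|α| + 1) < r) :
    ‖b.blowUp hcross κ (b.railHiPsi κ α) - pt3 α 1 0‖ ≤ ε * (|α| + 1) := by
  have hq := norm_railHiParam_lt hκ hα
  have key := hf.flat (pt2 (κ * α) κ) 0 hq (by simpa using hf.r_pos)
  have hF0 : b.Fband 0 = b.pZero := rfl
  rw [hF0, sub_zero] at key
  have e : b.blowUp hcross κ (b.railHiPsi κ α) - pt3 α 1 0 =
      κ⁻¹ • ((b.frame hcross).symm (b.Fband (pt2 (κ * α) κ) - b.pZero) -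
        WithLp.toLp 2 ![(pt2 (κ * α) κ : 𝔼 2) 0 - (0 : 𝔼 2) 0, (pt2 (κ * α) κ : 𝔼 2) 1 - (0 : 𝔼 2) 1, 0]) := by
    rw [smul_sub, blowUp, railHiPsi]
    congr 1
    ext i; fin_cases i <;> simp [hκ.ne']
  rw [e, norm_smul, Real.norm_eq_abs, abs_inv, abs_of_pos hκ]
  have hε : 0 ≤ ε := hf.eps_nonneg
  calc κ⁻¹ * _ ≤ κ⁻¹ * (ε * ‖(pt2 (κ * α) κ : 𝔼 2)‖) := by gcongr
    _ ≤ κ⁻¹ * (ε * (κ * (|α| + 1))) := by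
        have := norm_railParam_le hκ α 1 (by simp)
        rw [one_mul] at this
        gcongr
    _ = ε * (|α| + 1) := by field_simp

/-- Coordinates of the lower rail in blow-up coordinates: `|Y₀ - α|, |Y₁ + 1|, |Y₂| ≤ ε (|α| + 1)`.
[folklore] -/
theorem blowUp_railLoPsi_coord {α : ℝ} (hα : κ * (|α| + 1) < r) :
    |b.blowUp hcross κ (b.railLoPsi κ α) 0 - α| ≤ ε * (|α| + 1) ∧
      |b.blowUp hcross κ (b.railLoPsi κ α) 1 + 1| ≤ ε * (|α| + 1) ∧
        |b.blowUp hcross κ (b.railLoPsi κ α) 2| ≤ ε * (|α| + 1) := by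
  have h := b.norm_blowUp_railLoPsi_sub_le hf hκ hα
  refine ⟨?_, ?_, ?_⟩
  · have := (BandFoliation.abs_apply_le_norm _ 0).trans h; simpa using this
  · have := (BandFoliation.abs_apply_le_norm _ 1).trans h; simpa [sub_neg_eq_add] using this
  · have := (BandFoliation.abs_apply_le_norm _ 2).trans h; simpa using this

/-- Coordinates of the upper rail in blow-up coordinates. [folklore] -/
theorem blowUp_railHiPsi_coord {α : ℝ} (hα : κ * (|α| + 1) < r) :
    |b.blowUp hcross κ (b.railHiPsi κ α) 0 - α| ≤ ε * (|α| + 1) ∧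
      |b.blowUp hcross κ (b.railHiPsi κ α) 1 - 1| ≤ ε * (|α| + 1) ∧
        |b.blowUp hcross κ (b.railHiPsi κ α) 2| ≤ ε * (|α| + 1) := by
  have h := b.norm_blowUp_railHiPsi_sub_le hf hκ hα
  refine ⟨?_, ?_, ?_⟩
  · have := (BandFoliation.abs_apply_le_norm _ 0).trans h; simpa using this
  · have := (BandFoliation.abs_apply_le_norm _ 1).trans h; simpa using this
  · have := (BandFoliation.abs_apply_le_norm _ 2).trans h; simpa using this

/-! ### Derivatives of the rails in blow-up coordinates -/

omit hf hκ in
/-- The derivative of the lower rail at scale `κ`. [folklore] -/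
theorem hasDerivAt_railLoPsi {α : ℝ} (hα : ‖(pt2 (κ * α) (-κ) : 𝔼 2)‖ < b.poleRad hcross) :
    HasDerivAt (b.railLoPsi κ) (κ • fderiv ℝ b.Fband (pt2 (κ * α) (-κ)) (pt2 1 0)) α := by
  have hF := (b.differentiableAt_Fband hcross hα).hasFDerivAt
  have hc : HasDerivAt (fun a : ℝ ↦ (pt2 (κ * a) (-κ) : 𝔼 2)) ((κ * 1) • pt2 1 0) α := by
    have e : (fun a : ℝ ↦ (pt2 (κ * a) (-κ) : 𝔼 2)) = fun a ↦ (κ * a) • pt2 1 0 + pt2 0 (-κ) := by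
      funext a; ext i; fin_cases i <;> simp
    rw [e]
    exact (((hasDerivAt_id α).const_mul κ).smul_const (pt2 (1 : ℝ) 0)).add_const _
  have h := hF.comp_hasDerivAt_of_eq α hc rfl
  rw [mul_one, map_smul] at h
  exact h

omit hf hκ in
/-- The derivative of the upper rail at scale `κ`. [folklore] -/
theorem hasDerivAt_railHiPsi {α : ℝ} (hα : ‖(pt2 (κ * α) κ : 𝔼 2)‖ < b.poleRad hcross) :
    HasDerivAt (b.railHiPsi κ) (κ • fderiv ℝ b.Fband (pt2 (κ * α) κ) (pt2 1 0)) α := by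
  have hF := (b.differentiableAt_Fband hcross hα).hasFDerivAt
  have hc : HasDerivAt (fun a : ℝ ↦ (pt2 (κ * a) κ : 𝔼 2)) ((κ * 1) • pt2 1 0) α := by
    have e : (fun a : ℝ ↦ (pt2 (κ * a) κ : 𝔼 2)) = fun a ↦ (κ * a) • pt2 1 0 + pt2 0 κ := by
      funext a; ext i; fin_cases i <;> simp
    rw [e]
    exact (((hasDerivAt_id α).const_mul κ).smul_const (pt2 (1 : ℝ) 0)).add_const _
  have h := hF.comp_hasDerivAt_of_eq α hc rfl
  rw [mul_one, map_smul] at h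
  exact h

omit hf in
/-- The derivative of a curve in blow-up coordinates. [folklore] -/
theorem hasDerivAt_blowUp_comp {c : ℝ → 𝔼 3} {v : 𝔼 3} {α : ℝ} (hc : HasDerivAt c (κ • v) α) :
    HasDerivAt (fun a ↦ b.blowUp hcross κ (c a)) ((b.frame hcross).symm v) α := by
  have h1 : HasDerivAt (fun a ↦ c a - b.pZero) (κ • v) α := hc.sub_const _
  have h2 := ((b.frame hcross).symm : (𝔼 3) →L[ℝ] 𝔼 3).hasFDerivAt.comp_hasDerivAt α h1
  have h3 := h2.const_smul κ⁻¹
  have e : κ⁻¹ • ((b.frame hcross).symm : (𝔼 3) →L[ℝ] 𝔼 3) (κ • v) = (b.frame hcross).symm v := by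
    rw [map_smul, smul_smul, inv_mul_cancel₀ hκ.ne', one_smul]; rfl
  rw [e] at h3
  exact h3

/-- **The lower rail in blow-up coordinates has derivative `ε`-close to `(1, 0, 0)`.** [folklore] -/
theorem hasDerivAt_blowUp_railLoPsi {α : ℝ} (hα : κ * (|α| + 1) < r) :
    ∃ V : 𝔼 3, HasDerivAt (fun a ↦ b.blowUp hcross κ (b.railLoPsi κ a)) V α ∧ ‖V - pt3 1 0 0‖ ≤ ε := by
  have hq := norm_railLoParam_lt hκ hα
  refine ⟨(b.frame hcross).symm (fderiv ℝ b.Fband (pt2 (κ * α) (-κ)) (pt2 1 0)),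
    b.hasDerivAt_blowUp_comp hκ (b.hasDerivAt_railLoPsi (hq.trans_le hf.r_le)), ?_⟩
  have h := hf.flat_fderiv _ hq (pt2 1 0)
  have hn : ‖(pt2 1 0 : 𝔼 2)‖ = 1 := by rw [EuclideanSpace.norm_eq]; simp [Fin.sum_univ_two]
  rw [hn, mul_one] at h
  convert h using 3
  ext i; fin_cases i <;> simp

/-- The upper rail in blow-up coordinates has derivative `ε`-close to `(1, 0, 0)`. [folklore] -/
theorem hasDerivAt_blowUp_railHiPsi {α : ℝ} (hα : κ * (|α| + 1) < r) :
    ∃ V : 𝔼 3, HasDerivAt (fun a ↦ b.blowUp hcross κ (b.railHiPsi κ a)) V α ∧ ‖V - pt3 1 0 0‖ ≤ ε := by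
  have hq := norm_railHiParam_lt hκ hα
  refine ⟨(b.frame hcross).symm (fderiv ℝ b.Fband (pt2 (κ * α) κ) (pt2 1 0)),
    b.hasDerivAt_blowUp_comp hκ (b.hasDerivAt_railHiPsi (hq.trans_le hf.r_le)), ?_⟩
  have h := hf.flat_fderiv _ hq (pt2 1 0)
  have hn : ‖(pt2 1 0 : 𝔼 2)‖ = 1 := by rw [EuclideanSpace.norm_eq]; simp [Fin.sum_univ_two]
  rw [hn, mul_one] at h
  convert h using 3
  ext i; fin_cases i <;> simp

/-! ### The first blow-up coordinate of the pieces is strictly increasing -/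

/-- **Derivative of the first blow-up coordinate of the spiked lower piece**, with the lower bound
`1 - ε - B ε (|α| + 1)` for `u ∈ [0, 1]`. [folklore] -/
theorem hasDerivAt_blowUp_pieceLo_zero {u α : ℝ} (hu : u ∈ Icc (0 : ℝ) 1) (σ : ℝ) (hα : κ * (|α| + 1) < r) :
    ∃ g' : ℝ, HasDerivAt (fun a ↦ b.blowUp hcross κ (b.pieceLo hcross κ σ u a) 0) g' α ∧
      1 - ε - bumpBound * ε * (|α| + 1) ≤ g' := by
  obtain ⟨V, hV, hVb⟩ := b.hasDerivAt_blowUp_railLoPsi hf hκ hα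
  set R : ℝ → ℝ := fun a ↦ b.blowUp hcross κ (b.railLoPsi κ a) 0 with hR
  have hR' : HasDerivAt R (V 0) α := by
    have := ((EuclideanSpace.proj (0 : Fin 3) : 𝔼 3 →L[ℝ] ℝ).hasFDerivAt).comp_hasDerivAt α hV
    exact this
  have hβ := hasDerivAt_spikeBump α
  -- the function is `(1 - u β) R + u β α`
  have e : (fun a ↦ b.blowUp hcross κ (b.pieceLo hcross κ σ u a) 0) =
      fun a ↦ (1 - u * spikeBump a) * R a + u * spikeBump a * a := by
    funext a; rw [b.blowUp_pieceLo_zero hcross hκ.ne']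
  have h1 : HasDerivAt (fun a ↦ (1 - u * spikeBump a) * R a)
      ((-(u * deriv spikeBump α)) * R α + (1 - u * spikeBump α) * V 0) α :=
    (((hβ.const_mul u).const_sub 1).mul hR').congr_deriv (by ring)
  have h2 : HasDerivAt (fun a ↦ u * spikeBump a * a) (u * deriv spikeBump α * α + u * spikeBump α * 1) α :=
    (hβ.const_mul u).mul (hasDerivAt_id α)
  refine ⟨_, by rw [e]; exact h1.add h2, ?_⟩
  -- the bound
  obtain ⟨hB0, hB⟩ := bumpBound_spec
  have hβ01 := spikeBump_mem_Icc α
  have hVb0 : |V 0 - 1| ≤ ε := by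
    have := (BandFoliation.abs_apply_le_norm (V - pt3 1 0 0) 0).trans hVb; simpa using this
  have hR0 : |R α - α| ≤ ε * (|α| + 1) := (b.blowUp_railLoPsi_coord hf hκ hα).1
  have hε := hf.eps_nonneg
  have hw0 : 0 ≤ u * spikeBump α := mul_nonneg hu.1 hβ01.1
  have hw1 : u * spikeBump α ≤ 1 := by nlinarith [hu.2, hβ01.2, hu.1, hβ01.1]
  have hd : |deriv spikeBump α| ≤ bumpBound := hB α
  -- `g' = (1 - w) V₀ + w + u β' (α - R)`
  have eg : (-(u * deriv spikeBump α)) * R α + (1 - u * spikeBump α) * V 0 +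
      (u * deriv spikeBump α * α + u * spikeBump α * 1) =
      (1 - u * spikeBump α) * V 0 + u * spikeBump α + u * deriv spikeBump α * (α - R α) := by ring
  rw [eg]
  have t1 : (1 - u * spikeBump α) * (1 - ε) ≤ (1 - u * spikeBump α) * V 0 := by
    apply mul_le_mul_of_nonneg_left _ (by linarith)
    linarith [(abs_le.1 hVb0).1]
  have t3 : -(bumpBound * ε * (|α| + 1)) ≤ u * deriv spikeBump α * (α - R α) := by
    have h3 : |u * deriv spikeBump α * (α - R α)| ≤ bumpBound * ε * (|α| + 1) := by
      rw [abs_mul, abs_mul, abs_of_nonneg hu.1]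
      have hαR : |α - R α| ≤ ε * (|α| + 1) := by rw [abs_sub_comm]; exact hR0
      calc u * |deriv spikeBump α| * |α - R α| ≤ 1 * bumpBound * (ε * (|α| + 1)) := by
            apply mul_le_mul _ hαR (abs_nonneg _) (mul_nonneg zero_le_one hB0)
            exact mul_le_mul hu.2 hd (abs_nonneg _) zero_le_one
        _ = bumpBound * ε * (|α| + 1) := by ring
    linarith [(abs_le.1 h3).1]
  nlinarith [t1, t3, hw0, hw1, hε]

/-- **Derivative of the first blow-up coordinate of the spiked upper piece.** [folklore] -/
theorem hasDerivAt_blowUp_pieceHi_zero {u α : ℝ} (hu : u ∈ Icc (0 : ℝ) 1) (σ : ℝ) (hα : κ * (|α| + 1) < r) :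
    ∃ g' : ℝ, HasDerivAt (fun a ↦ b.blowUp hcross κ (b.pieceHi hcross κ σ u a) 0) g' α ∧
      1 - ε - bumpBound * ε * (|α| + 1) ≤ g' := by
  obtain ⟨V, hV, hVb⟩ := b.hasDerivAt_blowUp_railHiPsi hf hκ hα
  set R : ℝ → ℝ := fun a ↦ b.blowUp hcross κ (b.railHiPsi κ a) 0 with hR
  have hR' : HasDerivAt R (V 0) α := by
    have := ((EuclideanSpace.proj (0 : Fin 3) : 𝔼 3 →L[ℝ] ℝ).hasFDerivAt).comp_hasDerivAt α hV
    exact this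
  have hβ := hasDerivAt_spikeBump α
  have e : (fun a ↦ b.blowUp hcross κ (b.pieceHi hcross κ σ u a) 0) =
      fun a ↦ (1 - u * spikeBump a) * R a + u * spikeBump a * a := by
    funext a; rw [b.blowUp_pieceHi_zero hcross hκ.ne']
  have h1 : HasDerivAt (fun a ↦ (1 - u * spikeBump a) * R a)
      ((-(u * deriv spikeBump α)) * R α + (1 - u * spikeBump α) * V 0) α :=
    (((hβ.const_mul u).const_sub 1).mul hR').congr_deriv (by ring)
  have h2 : HasDerivAt (fun a ↦ u * spikeBump a * a) (u * deriv spikeBump α * α + u * spikeBump α * 1) α :=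
    (hβ.const_mul u).mul (hasDerivAt_id α)
  refine ⟨_, by rw [e]; exact h1.add h2, ?_⟩
  obtain ⟨hB0, hB⟩ := bumpBound_spec
  have hβ01 := spikeBump_mem_Icc α
  have hVb0 : |V 0 - 1| ≤ ε := by
    have := (BandFoliation.abs_apply_le_norm (V - pt3 1 0 0) 0).trans hVb; simpa using this
  have hR0 : |R α - α| ≤ ε * (|α| + 1) := (b.blowUp_railHiPsi_coord hf hκ hα).1
  have hε := hf.eps_nonneg
  have hw0 : 0 ≤ u * spikeBump α := mul_nonneg hu.1 hβ01.1
  have hw1 : u * spikeBump α ≤ 1 := by nlinarith [hu.2, hβ01.2, hu.1, hβ01.1]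
  have hd : |deriv spikeBump α| ≤ bumpBound := hB α
  have eg : (-(u * deriv spikeBump α)) * R α + (1 - u * spikeBump α) * V 0 +
      (u * deriv spikeBump α * α + u * spikeBump α * 1) =
      (1 - u * spikeBump α) * V 0 + u * spikeBump α + u * deriv spikeBump α * (α - R α) := by ring
  rw [eg]
  have t1 : (1 - u * spikeBump α) * (1 - ε) ≤ (1 - u * spikeBump α) * V 0 := by
    apply mul_le_mul_of_nonneg_left _ (by linarith)
    linarith [(abs_le.1 hVb0).1]
  have t3 : -(bumpBound * ε * (|α| + 1)) ≤ u * deriv spikeBump α * (α - R α) := by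
    have h3 : |u * deriv spikeBump α * (α - R α)| ≤ bumpBound * ε * (|α| + 1) := by
      rw [abs_mul, abs_mul, abs_of_nonneg hu.1]
      have hαR : |α - R α| ≤ ε * (|α| + 1) := by rw [abs_sub_comm]; exact hR0
      calc u * |deriv spikeBump α| * |α - R α| ≤ 1 * bumpBound * (ε * (|α| + 1)) := by
            apply mul_le_mul _ hαR (abs_nonneg _) (mul_nonneg zero_le_one hB0)
            exact mul_le_mul hu.2 hd (abs_nonneg _) zero_le_one
        _ = bumpBound * ε * (|α| + 1) := by ring
    linarith [(abs_le.1 h3).1]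
  nlinarith [t1, t3, hw0, hw1, hε]

/-! ### Consequences on an interval `[-A, A]` in the flat regime -/

omit b hf hκ in
/-- Points of `[-A, A]` satisfy the scale condition when `κ (A + 1) < r`. [folklore] -/
theorem scale_of_mem_Icc {A' α : ℝ} (hκ : 0 < κ) (hA : κ * (A' + 1) < r) (hα : α ∈ Icc (-A') A') :
    κ * (|α| + 1) < r :=
  lt_of_le_of_lt (by have := abs_le.2 ⟨hα.1, hα.2⟩; nlinarith [hκ.le]) hA

/-- **The first blow-up coordinate of the spiked lower piece is strictly increasing on `[-A, A]`**
when `ε (1 + B (A + 1)) ≤ 1/2` and `κ (A + 1) < r`. [folklore] -/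
theorem strictMonoOn_blowUp_pieceLo_zero {A' u : ℝ} (hu : u ∈ Icc (0 : ℝ) 1) (σ : ℝ) (hA : κ * (A' + 1) < r)
    (hgood : ε * (1 + bumpBound * (A' + 1)) ≤ 1 / 2) :
    StrictMonoOn (fun a ↦ b.blowUp hcross κ (b.pieceLo hcross κ σ u a) 0) (Icc (-A') A') := by
  have hder : ∀ a ∈ Icc (-A') A', ∃ g', HasDerivAt (fun a ↦ b.blowUp hcross κ (b.pieceLo hcross κ σ u a) 0) g' a ∧ 1 / 2 ≤ g' := by
    intro a ha
    obtain ⟨g', hg', hb⟩ := b.hasDerivAt_blowUp_pieceLo_zero hf hκ hu σ (scale_of_mem_Icc hκ hA ha)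
    refine ⟨g', hg', le_trans ?_ hb⟩
    have h1 : |a| ≤ A' := abs_le.2 ⟨ha.1, ha.2⟩
    have hε := hf.eps_nonneg
    have hB := bumpBound_spec.1
    nlinarith [mul_nonneg (mul_nonneg hB hε) (by linarith [abs_nonneg a] : (0 : ℝ) ≤ A' - |a|)]
  refine strictMonoOn_of_deriv_pos (convex_Icc _ _) (fun a ha ↦ ?_) (fun a ha ↦ ?_)
  · obtain ⟨g', hg', -⟩ := hder a ha
    exact hg'.continuousAt.continuousWithinAt
  · obtain ⟨g', hg', hb⟩ := hder a (interior_subset ha)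
    rw [hg'.deriv]; linarith

/-- The first blow-up coordinate of the spiked upper piece is strictly increasing on `[-A, A]`.
[folklore] -/
theorem strictMonoOn_blowUp_pieceHi_zero {A' u : ℝ} (hu : u ∈ Icc (0 : ℝ) 1) (σ : ℝ) (hA : κ * (A' + 1) < r)
    (hgood : ε * (1 + bumpBound * (A' + 1)) ≤ 1 / 2) :
    StrictMonoOn (fun a ↦ b.blowUp hcross κ (b.pieceHi hcross κ σ u a) 0) (Icc (-A') A') := by
  have hder : ∀ a ∈ Icc (-A') A', ∃ g', HasDerivAt (fun a ↦ b.blowUp hcross κ (b.pieceHi hcross κ σ u a) 0) g' a ∧ 1 / 2 ≤ g' := by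
    intro a ha
    obtain ⟨g', hg', hb⟩ := b.hasDerivAt_blowUp_pieceHi_zero hf hκ hu σ (scale_of_mem_Icc hκ hA ha)
    refine ⟨g', hg', le_trans ?_ hb⟩
    have h1 : |a| ≤ A' := abs_le.2 ⟨ha.1, ha.2⟩
    have hε := hf.eps_nonneg
    have hB := bumpBound_spec.1
    nlinarith [mul_nonneg (mul_nonneg hB hε) (by linarith [abs_nonneg a] : (0 : ℝ) ≤ A' - |a|)]
  refine strictMonoOn_of_deriv_pos (convex_Icc _ _) (fun a ha ↦ ?_) (fun a ha ↦ ?_)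
  · obtain ⟨g', hg', -⟩ := hder a ha
    exact hg'.continuousAt.continuousWithinAt
  · obtain ⟨g', hg', hb⟩ := hder a (interior_subset ha)
    rw [hg'.deriv]; linarith

/-- **The spiked lower piece is injective on `[-A, A]`** in the flat regime. [folklore] -/
theorem injOn_pieceLo {A' u : ℝ} (hu : u ∈ Icc (0 : ℝ) 1) (σ : ℝ) (hA : κ * (A' + 1) < r)
    (hgood : ε * (1 + bumpBound * (A' + 1)) ≤ 1 / 2) :
    InjOn (b.pieceLo hcross κ σ u) (Icc (-A') A') := fun a ha a' ha' h ↦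
  (b.strictMonoOn_blowUp_pieceLo_zero hf hκ hu σ hA hgood).injOn ha ha' (by simp only [h])

/-- The spiked upper piece is injective on `[-A, A]` in the flat regime. [folklore] -/
theorem injOn_pieceHi {A' u : ℝ} (hu : u ∈ Icc (0 : ℝ) 1) (σ : ℝ) (hA : κ * (A' + 1) < r)
    (hgood : ε * (1 + bumpBound * (A' + 1)) ≤ 1 / 2) :
    InjOn (b.pieceHi hcross κ σ u) (Icc (-A') A') := fun a ha a' ha' h ↦
  (b.strictMonoOn_blowUp_pieceHi_zero hf hκ hu σ hA hgood).injOn ha ha' (by simp only [h])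

/-- **The spiked lower piece is regular**: a derivative vector in the flat regime is nonzero.
[folklore] -/
theorem ne_zero_of_hasDerivAt_pieceLo {u α : ℝ} (hu : u ∈ Icc (0 : ℝ) 1) {σ : ℝ} (hα : κ * (|α| + 1) < r)
    (hgood : ε * (1 + bumpBound * (|α| + 1)) ≤ 1 / 2) {W : 𝔼 3}
    (hW : HasDerivAt (b.pieceLo hcross κ σ u) W α) : W ≠ 0 := by
  intro hW0
  obtain ⟨g', hg', hb⟩ := b.hasDerivAt_blowUp_pieceLo_zero hf hκ hu σ hα
  have h1 : HasDerivAt (fun a ↦ b.blowUp hcross κ (b.pieceLo hcross κ σ u a)) ((b.frame hcross).symm (κ⁻¹ • W)) α :=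
    b.hasDerivAt_blowUp_comp hκ (by rwa [smul_smul, mul_inv_cancel₀ hκ.ne', one_smul])
  have h2 : HasDerivAt (fun a ↦ b.blowUp hcross κ (b.pieceLo hcross κ σ u a) 0) (((b.frame hcross).symm (κ⁻¹ • W)) 0) α :=
    ((EuclideanSpace.proj (0 : Fin 3) : 𝔼 3 →L[ℝ] ℝ).hasFDerivAt).comp_hasDerivAt α h1
  have h3 := hg'.unique h2
  rw [hW0, smul_zero, map_zero] at h3
  have hε := hf.eps_nonneg
  have hB := bumpBound_spec.1
  have : (1 : ℝ) / 2 ≤ g' := by nlinarith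
  rw [h3] at this
  simp at this
  linarith

/-- The spiked upper piece is regular. [folklore] -/
theorem ne_zero_of_hasDerivAt_pieceHi {u α : ℝ} (hu : u ∈ Icc (0 : ℝ) 1) {σ : ℝ} (hα : κ * (|α| + 1) < r)
    (hgood : ε * (1 + bumpBound * (|α| + 1)) ≤ 1 / 2) {W : 𝔼 3}
    (hW : HasDerivAt (b.pieceHi hcross κ σ u) W α) : W ≠ 0 := by
  intro hW0
  obtain ⟨g', hg', hb⟩ := b.hasDerivAt_blowUp_pieceHi_zero hf hκ hu σ hα
  have h1 : HasDerivAt (fun a ↦ b.blowUp hcross κ (b.pieceHi hcross κ σ u a)) ((b.frame hcross).symm (κ⁻¹ • W)) α :=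
    b.hasDerivAt_blowUp_comp hκ (by rwa [smul_smul, mul_inv_cancel₀ hκ.ne', one_smul])
  have h2 : HasDerivAt (fun a ↦ b.blowUp hcross κ (b.pieceHi hcross κ σ u a) 0) (((b.frame hcross).symm (κ⁻¹ • W)) 0) α :=
    ((EuclideanSpace.proj (0 : Fin 3) : 𝔼 3 →L[ℝ] ℝ).hasFDerivAt).comp_hasDerivAt α h1
  have h3 := hg'.unique h2
  rw [hW0, smul_zero, map_zero] at h3
  have hε := hf.eps_nonneg
  have hB := bumpBound_spec.1
  have : (1 : ℝ) / 2 ≤ g' := by nlinarith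
  rw [h3] at this
  simp at this
  linarith

/-! ### The second blow-up coordinate separates the two pieces -/

/-- **The second blow-up coordinate of the spiked lower piece is `≤ -1/6`** when `ε (|α| + 1) ≤ 5/6`.
[folklore] -/
theorem blowUp_pieceLo_one_le {u α : ℝ} (hu : u ∈ Icc (0 : ℝ) 1) (σ : ℝ) (hα : κ * (|α| + 1) < r)
    (hε : ε * (|α| + 1) ≤ 5 / 6) : b.blowUp hcross κ (b.pieceLo hcross κ σ u α) 1 ≤ -(1 / 6) := by
  rw [b.blowUp_pieceLo_one hcross hκ.ne']
  have hR := (b.blowUp_railLoPsi_coord hf hκ hα).2.1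
  have hR1 : b.blowUp hcross κ (b.railLoPsi κ α) 1 ≤ -(1 / 6) := by linarith [(abs_le.1 hR).2]
  have hs : -1 + spikeProfile α ≤ -(1 / 6) := by linarith [spikeProfile_le α]
  have hβ01 := spikeBump_mem_Icc α
  have hw0 : 0 ≤ u * spikeBump α := mul_nonneg hu.1 hβ01.1
  have hw1 : u * spikeBump α ≤ 1 := by nlinarith [hu.2, hβ01.2, hu.1, hβ01.1]
  nlinarith

/-- **The second blow-up coordinate of the spiked upper piece is `≥ 1/6`.** [folklore] -/
theorem le_blowUp_pieceHi_one {u α : ℝ} (hu : u ∈ Icc (0 : ℝ) 1) (σ : ℝ) (hα : κ * (|α| + 1) < r)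
    (hε : ε * (|α| + 1) ≤ 5 / 6) : 1 / 6 ≤ b.blowUp hcross κ (b.pieceHi hcross κ σ u α) 1 := by
  rw [b.blowUp_pieceHi_one hcross hκ.ne']
  have hR := (b.blowUp_railHiPsi_coord hf hκ hα).2.1
  have hR1 : 1 / 6 ≤ b.blowUp hcross κ (b.railHiPsi κ α) 1 := by linarith [(abs_le.1 hR).1]
  have hs : 1 / 6 ≤ 1 - spikeProfile α := by linarith [spikeProfile_le α]
  have hβ01 := spikeBump_mem_Icc α
  have hw0 : 0 ≤ u * spikeBump α := mul_nonneg hu.1 hβ01.1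
  have hw1 : u * spikeBump α ≤ 1 := by nlinarith [hu.2, hβ01.2, hu.1, hβ01.1]
  nlinarith

/-- **The two spiked pieces are disjoint** in the flat regime. [folklore] -/
theorem pieceLo_ne_pieceHi {u u' α α' : ℝ} (hu : u ∈ Icc (0 : ℝ) 1) (hu' : u' ∈ Icc (0 : ℝ) 1) (σ : ℝ)
    (hα : κ * (|α| + 1) < r) (hα' : κ * (|α'| + 1) < r) (hε : ε * (|α| + 1) ≤ 5 / 6) (hε' : ε * (|α'| + 1) ≤ 5 / 6) :
    b.pieceLo hcross κ σ u α ≠ b.pieceHi hcross κ σ u' α' := by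
  intro h
  have h1 := b.blowUp_pieceLo_one_le hf hκ hu σ hα hε
  have h2 := b.le_blowUp_pieceHi_one hf hκ hu' σ hα' hε'
  rw [h] at h1
  linarith

/-! ### The pieces stay at distance `O(κ)` from the crossing point -/

omit b hf hκ in
/-- The norm of `(x, y, z)` is at most `|x| + |y| + |z|`. [folklore] -/
theorem norm_pt3_le (x y z : ℝ) : ‖(pt3 x y z : 𝔼 3)‖ ≤ |x| + |y| + |z| := by
  have e : (pt3 x y z : 𝔼 3) = x • pt3 1 0 0 + y • pt3 0 1 0 + z • pt3 0 0 1 := by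
    ext i; fin_cases i <;> simp
  have h1 : ‖(pt3 1 0 0 : 𝔼 3)‖ = 1 := by rw [EuclideanSpace.norm_eq]; simp [Fin.sum_univ_three]
  have h2 : ‖(pt3 0 1 0 : 𝔼 3)‖ = 1 := by rw [EuclideanSpace.norm_eq]; simp [Fin.sum_univ_three]
  have h3 : ‖(pt3 0 0 1 : 𝔼 3)‖ = 1 := by rw [EuclideanSpace.norm_eq]; simp [Fin.sum_univ_three]
  rw [e]
  calc ‖x • (pt3 1 0 0 : 𝔼 3) + y • pt3 0 1 0 + z • pt3 0 0 1‖
      ≤ ‖x • (pt3 1 0 0 : 𝔼 3) + y • pt3 0 1 0‖ + ‖z • (pt3 0 0 1 : 𝔼 3)‖ := norm_add_le _ _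
    _ ≤ ‖x • (pt3 1 0 0 : 𝔼 3)‖ + ‖y • (pt3 0 1 0 : 𝔼 3)‖ + ‖z • (pt3 0 0 1 : 𝔼 3)‖ := by
        gcongr; exact norm_add_le _ _
    _ = |x| + |y| + |z| := by
        rw [norm_smul, norm_smul, norm_smul, Real.norm_eq_abs, Real.norm_eq_abs, Real.norm_eq_abs, h1, h2, h3]
        ring

omit b hf hκ in
/-- On `(1/8, 4)` the spike profile lies in `[-1/6, 5/6]`. [folklore] -/
theorem abs_spikeProfile_le {α : ℝ} (h : α ∈ Ioo (1 / 8 : ℝ) 4) : |spikeProfile α| ≤ 5 / 6 := by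
  rw [abs_le]
  refine ⟨?_, spikeProfile_le α⟩
  rcases le_or_gt (1 / 4) α with h1 | h1
  · linarith [spikeProfile_nonneg h1]
  · rw [spikeProfile_of_le (by linarith)]
    rw [le_div_iff₀ (by norm_num)]; linarith [h.1]

omit b hf hκ in
/-- On `(1/8, 4)` the lower model path has norm at most `|α| + 2 + |σ|`. [folklore] -/
theorem norm_modelLo_le {σ α : ℝ} (h : α ∈ Ioo (1 / 8 : ℝ) 4) : ‖modelLo σ α‖ ≤ |α| + 2 + |σ| := by
  have hs := abs_le.1 (abs_spikeProfile_le h)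
  refine (norm_pt3_le _ _ _).trans ?_
  have h1 : |-1 + spikeProfile α| ≤ 11 / 6 := abs_le.2 ⟨by linarith, by linarith⟩
  have h2 : |σ * spikeProfile α| ≤ |σ| := by
    rw [abs_mul]; exact mul_le_of_le_one_right (abs_nonneg σ) ((abs_spikeProfile_le h).trans (by norm_num))
  linarith

omit b hf hκ in
/-- On `(1/8, 4)` the upper model path has norm at most `|α| + 2 + |σ|`. [folklore] -/
theorem norm_modelHi_le {σ α : ℝ} (h : α ∈ Ioo (1 / 8 : ℝ) 4) : ‖modelHi σ α‖ ≤ |α| + 2 + |σ| := by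
  have hs := abs_le.1 (abs_spikeProfile_le h)
  refine (norm_pt3_le _ _ _).trans ?_
  have h1 : |1 - spikeProfile α| ≤ 11 / 6 := abs_le.2 ⟨by linarith, by linarith⟩
  have h2 : |σ * spikeProfile α| ≤ |σ| := by
    rw [abs_mul]; exact mul_le_of_le_one_right (abs_nonneg σ) ((abs_spikeProfile_le h).trans (by norm_num))
  linarith

/-- **The spiked lower piece stays within blow-up norm `|α| + 2 + |σ|`** (for `ε (|α| + 1) ≤ 1`).
[folklore] -/
theorem norm_blowUp_pieceLo_le {u α : ℝ} (hu : u ∈ Icc (0 : ℝ) 1) (σ : ℝ) (hα : κ * (|α| + 1) < r)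
    (hε : ε * (|α| + 1) ≤ 1) : ‖b.blowUp hcross κ (b.pieceLo hcross κ σ u α)‖ ≤ |α| + 2 + |σ| := by
  rw [b.blowUp_pieceLo hcross hκ.ne']
  have hβ01 := spikeBump_mem_Icc α
  have hw0 : 0 ≤ u * spikeBump α := mul_nonneg hu.1 hβ01.1
  have hw1 : u * spikeBump α ≤ 1 := by nlinarith [hu.2, hβ01.2, hu.1, hβ01.1]
  have hR : ‖b.blowUp hcross κ (b.railLoPsi κ α)‖ ≤ |α| + 2 := by
    have h := b.norm_blowUp_railLoPsi_sub_le hf hκ hα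
    have h0 : ‖(pt3 α (-1) 0 : 𝔼 3)‖ ≤ |α| + 1 := (norm_pt3_le _ _ _).trans (by simp)
    have := norm_le_of_mem_closedBall (mem_closedBall_iff_norm.2 h)
    linarith [norm_sub_norm_le (b.blowUp hcross κ (b.railLoPsi κ α)) (pt3 α (-1) 0)]
  by_cases hmem : α ∈ Ioo (1 / 8 : ℝ) 4
  · have hM := norm_modelLo_le (σ := σ) hmem
    calc ‖(1 - u * spikeBump α) • b.blowUp hcross κ (b.railLoPsi κ α) + (u * spikeBump α) • modelLo σ α‖
        ≤ (1 - u * spikeBump α) * ‖b.blowUp hcross κ (b.railLoPsi κ α)‖ + u * spikeBump α * ‖modelLo σ α‖ := by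
          refine (norm_add_le _ _).trans ?_
          rw [norm_smul, norm_smul, Real.norm_eq_abs, Real.norm_eq_abs, abs_of_nonneg (by linarith), abs_of_nonneg hw0]
      _ ≤ (1 - u * spikeBump α) * (|α| + 2 + |σ|) + u * spikeBump α * (|α| + 2 + |σ|) := by
          gcongr; linarith [abs_nonneg σ]
      _ = |α| + 2 + |σ| := by ring
  · rw [spikeBump_eq_zero_of_not_mem hmem]
    simp only [mul_zero, sub_zero, one_smul, zero_smul, add_zero]
    linarith [abs_nonneg σ]

/-- The spiked upper piece stays within blow-up norm `|α| + 2 + |σ|`. [folklore] -/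
theorem norm_blowUp_pieceHi_le {u α : ℝ} (hu : u ∈ Icc (0 : ℝ) 1) (σ : ℝ) (hα : κ * (|α| + 1) < r)
    (hε : ε * (|α| + 1) ≤ 1) : ‖b.blowUp hcross κ (b.pieceHi hcross κ σ u α)‖ ≤ |α| + 2 + |σ| := by
  rw [b.blowUp_pieceHi hcross hκ.ne']
  have hβ01 := spikeBump_mem_Icc α
  have hw0 : 0 ≤ u * spikeBump α := mul_nonneg hu.1 hβ01.1
  have hw1 : u * spikeBump α ≤ 1 := by nlinarith [hu.2, hβ01.2, hu.1, hβ01.1]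
  have hR : ‖b.blowUp hcross κ (b.railHiPsi κ α)‖ ≤ |α| + 2 := by
    have h := b.norm_blowUp_railHiPsi_sub_le hf hκ hα
    have h0 : ‖(pt3 α 1 0 : 𝔼 3)‖ ≤ |α| + 1 := (norm_pt3_le _ _ _).trans (by simp)
    linarith [norm_sub_norm_le (b.blowUp hcross κ (b.railHiPsi κ α)) (pt3 α 1 0)]
  by_cases hmem : α ∈ Ioo (1 / 8 : ℝ) 4
  · have hM := norm_modelHi_le (σ := σ) hmem
    calc ‖(1 - u * spikeBump α) • b.blowUp hcross κ (b.railHiPsi κ α) + (u * spikeBump α) • modelHi σ α‖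
        ≤ (1 - u * spikeBump α) * ‖b.blowUp hcross κ (b.railHiPsi κ α)‖ + u * spikeBump α * ‖modelHi σ α‖ := by
          refine (norm_add_le _ _).trans ?_
          rw [norm_smul, norm_smul, Real.norm_eq_abs, Real.norm_eq_abs, abs_of_nonneg (by linarith), abs_of_nonneg hw0]
      _ ≤ (1 - u * spikeBump α) * (|α| + 2 + |σ|) + u * spikeBump α * (|α| + 2 + |σ|) := by
          gcongr; linarith [abs_nonneg σ]
      _ = |α| + 2 + |σ| := by ring
  · rw [spikeBump_eq_zero_of_not_mem hmem]
    simp only [mul_zero, sub_zero, one_smul, zero_smul, add_zero]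
    linarith [abs_nonneg σ]

omit hf in
/-- **Distance to the crossing point from the blow-up norm**: `‖y - pZero‖ ≤ κ ‖frame‖ ‖blowUp κ y‖`.
[folklore] -/
theorem norm_sub_pZero_le (y : 𝔼 3) :
    ‖y - b.pZero‖ ≤ κ * ‖((b.frame hcross : (𝔼 3) ≃L[ℝ] 𝔼 3) : (𝔼 3) →L[ℝ] 𝔼 3)‖ * ‖b.blowUp hcross κ y‖ := by
  have e : y - b.pZero = κ • b.frame hcross (b.blowUp hcross κ y) := by
    conv_lhs => rw [← b.blowDown_blowUp hcross hκ.ne' y]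
    simp [blowDown]
  rw [e, norm_smul, Real.norm_eq_abs, abs_of_pos hκ, mul_assoc]
  gcongr
  exact ((b.frame hcross : (𝔼 3) ≃L[ℝ] 𝔼 3) : (𝔼 3) →L[ℝ] 𝔼 3).le_opNorm _

/-! ### Smoothness of the pieces -/

omit hf hκ in
/-- **The spiked lower piece is jointly `C^∞`** in `(u, α)` wherever the rail parameter point is
within the pole-free radius. [folklore] -/
theorem contDiffAt_pieceLo (σ : ℝ) {u α : ℝ} (hα : ‖(pt2 (κ * α) (-κ) : 𝔼 2)‖ < b.poleRad hcross) :
    ContDiffAt ℝ ∞ (uncurry (b.pieceLo hcross κ σ)) (u, α) := by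
  have hβ : ContDiffAt ℝ ∞ (fun p : ℝ × ℝ ↦ p.1 * spikeBump p.2) (u, α) :=
    contDiffAt_fst.mul (contDiff_spikeBump.contDiffAt.comp _ contDiffAt_snd)
  have hc : ContDiff ℝ ∞ (fun p : ℝ × ℝ ↦ (pt2 (κ * p.2) (-κ) : 𝔼 2)) := by
    rw [contDiff_euclidean]
    intro i; fin_cases i
    · exact (contDiff_const.mul contDiff_snd)
    · exact contDiff_const
  have hR : ContDiffAt ℝ ∞ (fun p : ℝ × ℝ ↦ b.railLoPsi κ p.2) (u, α) :=
    (b.contDiffAt_Fband hcross hα).comp (u, α) hc.contDiffAt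
  have hM : ContDiffAt ℝ ∞ (fun p : ℝ × ℝ ↦ b.blowDown hcross κ (modelLo σ p.2)) (u, α) :=
    ((b.contDiff_blowDown hcross κ).comp ((contDiff_modelLo σ).comp contDiff_snd)).contDiffAt
  have h1 : ContDiffAt ℝ ∞ (fun p : ℝ × ℝ ↦ (1 : ℝ) - p.1 * spikeBump p.2) (u, α) := contDiffAt_const.sub hβ
  have e : uncurry (b.pieceLo hcross κ σ) = fun p : ℝ × ℝ ↦
      (1 - p.1 * spikeBump p.2) • b.railLoPsi κ p.2 + (p.1 * spikeBump p.2) • b.blowDown hcross κ (modelLo σ p.2) := by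
    funext p; rfl
  rw [e]; exact (h1.smul hR).add (hβ.smul hM)

omit hf hκ in
/-- The spiked upper piece is jointly `C^∞` in `(u, α)`. [folklore] -/
theorem contDiffAt_pieceHi (σ : ℝ) {u α : ℝ} (hα : ‖(pt2 (κ * α) κ : 𝔼 2)‖ < b.poleRad hcross) :
    ContDiffAt ℝ ∞ (uncurry (b.pieceHi hcross κ σ)) (u, α) := by
  have hβ : ContDiffAt ℝ ∞ (fun p : ℝ × ℝ ↦ p.1 * spikeBump p.2) (u, α) :=
    contDiffAt_fst.mul (contDiff_spikeBump.contDiffAt.comp _ contDiffAt_snd)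
  have hc : ContDiff ℝ ∞ (fun p : ℝ × ℝ ↦ (pt2 (κ * p.2) κ : 𝔼 2)) := by
    rw [contDiff_euclidean]
    intro i; fin_cases i
    · exact (contDiff_const.mul contDiff_snd)
    · exact contDiff_const
  have hR : ContDiffAt ℝ ∞ (fun p : ℝ × ℝ ↦ b.railHiPsi κ p.2) (u, α) :=
    (b.contDiffAt_Fband hcross hα).comp (u, α) hc.contDiffAt
  have hM : ContDiffAt ℝ ∞ (fun p : ℝ × ℝ ↦ b.blowDown hcross κ (modelHi σ p.2)) (u, α) :=
    ((b.contDiff_blowDown hcross κ).comp ((contDiff_modelHi σ).comp contDiff_snd)).contDiffAt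
  have h1 : ContDiffAt ℝ ∞ (fun p : ℝ × ℝ ↦ (1 : ℝ) - p.1 * spikeBump p.2) (u, α) := contDiffAt_const.sub hβ
  have e : uncurry (b.pieceHi hcross κ σ) = fun p : ℝ × ℝ ↦
      (1 - p.1 * spikeBump p.2) • b.railHiPsi κ p.2 + (p.1 * spikeBump p.2) • b.blowDown hcross κ (modelHi σ p.2) := by
    funext p; rfl
  rw [e]; exact (h1.smul hR).add (hβ.smul hM)

end Estimates

end BandData

end Literature.Topology.FourManifolds
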